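/-
Copyright: lit-balaban Phase-2 proof seat p30 (gen 28).  Statement-level skeleton of a published paper; no proof claims beyond what
the kernel checks below.
-/
import Literature.MathematicalPhysics.QuantumFieldTheory.BalabanImbrieJaffe1984to88.BIJ88NeumannPropagatorSmallFieldClose

/-!
# [BalabanImbrieJaffe1985] §7.3 p. 326 ⟵ [Balaban1983RegularityDecay] Theorem p. 573, (1.11)–(1.12): **THE `δG_k(□, Ω)`
# COVARIANT-DERIVATIVE MEMBER AT SMALL NON-FLAT `U(1)` FIELDS —
# `|(D_u(G_k(□,u)f − G_k(Ω,u)f))(⟨x, x+e_μ⟩)| ≤ (L^kε)c₂e^{−δ₂dist(x,supp f)/L^k}e^{−δ₂(dist(x,□^c)+dist(supp f,□^c))/L^k}‖f‖_∞`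
# ON THE DEEP ROWS OF NESTED BLOCK UNIONS `□ ⊆ Ω`, UNIFORMLY IN `k`** (the derivative companion of gen 27's value member
`BIJ88NeumannPropagatorSmallFieldClose.close112_smallField_of_inputs`)

T. Bałaban, J. Imbrie, A. Jaffe, *Renormalization of the Higgs model: minimizers, propagators and the stability of mean field theory*,
Commun. Math. Phys. **97** (1985) 299–329 [BalabanImbrieJaffe1985], row **C1.Eq7.3.1-7.3.2** (owner r15) / front **C2S14** (owner r18:
the `(H1.12)` DERIVATIVE input of the `(2.31)_k`-for-covariant-derivatives chain at plaquette-small non-flat fields — regular-`A` provider of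
record `BIJ85NeumannPropagatorRegularDeriv.input112_deriv_regular_deep`); [7] = T. Bałaban, *Regularity and decay of lattice Green's
functions*, Commun. Math. Phys. **89** (1983) 571–597 [Balaban1983RegularityDecay].

statement-level skeleton of published theorems with citation tags; proofs where landed; nothing here is a claim about the Yang–Mills mass gap

PDFs held and re-read this session: `paper:balaban1983-cmp89-regularity-decay` p. 573 = PDF 3, the Theorem, lines 12–25: *"(1.10)
|(D^η_{A,μ}G_k(Ω,A)f)(x)|, |(G_k(Ω,A)f)(x)| ≤ c₀exp(−δ₀dist(x, supp f))‖f‖_∞ for x ∈ Ω, dist(x,Ω^c) ≥ R₀.  If Ω ⊂ Ω₀, then for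
δG_k(Ω,Ω₀,A) defined by the equality δG_k(Ω,Ω₀,A) = G_k(Ω,A) − G_k(Ω₀,A), (1.11) we have the inequalities (1.5) and (1.6) (with the same
restrictions on x, x′) with the additional factor (1.12) [= exp(−δ₀dist(x, Ω^c))·exp(−δ₀dist(supp f, Ω^c))] on the right hand sides"* —
(1.5) is the pair *value, covariant derivative*; this file is the covariant-derivative half of (1.11)–(1.12);
`paper:balaban1985-cmp97-bij-higgs-minimizers` p. 326 = PDF 28, lines 18–22: *"The propagators arising from Δ_k(u_k), under the restriction
(7.3.1) on the gauge field, also satisfy the regularity and decay estimates of [7]."*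

WHAT THIS FILE PROVES (objects: p31's region Neumann propagators `G_k(X,u) = gBox (α_kL^{kd}) ε⁻¹ u k X` on the fine torus, `X` a union of
`k`-blocks (`IsBlockUnion`), the covariant derivative `covD ε⁻¹ u φ ⟨x,μ⟩ = ε⁻¹(u_{x,μ}φ(x+e_μ) − φ(x))` of `BIJ88Sect3Statements`,
`T(x,y) = |x − y|_∞` the sup torus distance in fine units = `B5Ineq137Torus.T P 0`):
* §1 kernel lemmas — the covariant derivative of a difference, the norm of a covariant derivative, `dist(supp f, □^c) ≤ dist(z, supp f) +
  dist(z, □^c)`, the exponent bookkeeping of the edge alternative, a real absorption step;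
* §2 the member of record **`close112_smallField_deriv_of_inputs`**: for `2 ≤ d ≤ 3`, `L` odd `> 1`, `a > 0`, `c₀ ≥ 0`, `δ₀ > 0` there
  are `c₂, δ₂ > 0` (depending on these only) such that for every volume, every `1 ≤ k ≤ K`, every `U(1)` field `u` with `|u(∂p) − 1| ≤ θ`,
  `2d³(L^{2k}θ)² ≤ 1`, all nested `k`-block unions `□ ⊆ Ω` on whose `□`-rows `G_k(□,u)`, `G_k(Ω,u)` obey the (H1.10″) VALUE bound with
  `(c₀, δ₀)` (gen 27's hypotheses verbatim) AND on whose rows `x` with `{y : |x − y|_∞ < L^k} ⊆ □` they obey the (H1.10″) COVARIANT-DERIVATIVE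
  bound with `(c₀, δ₀)` (p34's `decay110_smallField_cube_deriv_input` binder shape) — four HYPOTHESES —, every row `x ∈ □` with
  `dist_∞(x, T ∖ □) ≥ 14L^k`, every `f` supported in `□` (`‖f‖_∞ ≤ F`, `D ≤ dist(x, supp f)`, `D_b ≤ dist(x, □^c)`, `D_f ≤ dist(supp f, □^c)`)
  and every direction `μ`:
  `‖covD ε⁻¹ u (G_k(□,u)f) ⟨x,μ⟩ − covD ε⁻¹ u (G_k(Ω,u)f) ⟨x,μ⟩‖ ≤ (L^kε)·c₂e^{−δ₂D/L^k}e^{−δ₂(D_b + D_f)/L^k}·F`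
  — ONE power of the block spacing `L^kε` where the value member has two; and **`close112_smallField_deriv_deep`**, the same with the row
  condition written as `{y : |x − y|_∞ < 14L^k} ⊆ □` (r01's / p34's deep-row binder shape).

METHOD (ours; it is gen 25's proof of the covariant-derivative member of (1.10), `BIJ85ScalarPropagatorSupDecayDeriv.decay110_smallField_deriv`,
run for the difference `v = G_k(□)f − G_k(Ω)f`).  (a) `v` is `N(u)`-harmonic on the interior of `□` (gen 27
`nOp_univ_diff_apply_eq_zero`).  (b) WEIGHTED MAXIMUM over the bonds `b = ⟨z, z+e_ν⟩` with `dist_∞(z, T ∖ □) ≥ 14L^k`: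
`M = max e^{t(dist(z,supp f) + dist_∞(z,T∖□))/L^k}|u_bv(b₊) − v(b₋)|`.  (c) At the maximal bond `⟨y₀, μ₀⟩` gen 25's LOCAL INTERIOR GRADIENT
ESTIMATE `local_gradient_bound` (flat-kernel representation of a difference, radius `r = ⌊cL^k⌋ ≥ 4`, kernel envelopes
`BIJ85FlatPropagatorKernelDiffs.flat_kernel_diffs`) in the centred axial gauge of `BIJ85CentredAxialGauge` around `y₀`
(`|u′ − 1| ≤ (d−1)θ|y₀ − ·|_∞`, `(d−1)θL^{2k} ≤ 1`): the source vanishes on the ball (harmonicity), the values on the ball are bounded by gen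
27's δG VALUE member `close112_smallField_of_inputs` (this is where the factor (1.12) enters), the covariant differences on the ball are
bounded by `M` inside the region and — on the `2r`-collar of the region, where `dist(supp f, □^c) ≤ dist(z, supp f) + 14L^k` makes the
factor (1.12) cost only `e^{28t}` — by the two (H1.10″)-`D` members.  (d) Absorption `C_Lγr²e ≤ ½` by the choice of `c` (gen 25's
`gamma_nsq_le_one`), whence `M ≲ ε·(L^kε)·e^{−tD_f/L^k}F`; the small case `cL^k < 4` by two values.  `□ = T` is trivial.

HONEST SCOPE.  (i) `U(1)` only, `2 ≤ d ≤ 3`, `L` odd `> 1`, `1 ≤ k ≤ K` — as gen 25/27 and p27/p34's members.  (ii) COVARIANT-DERIVATIVE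
member of (1.11)–(1.12) only (value member = gen 27; the Hölder member is not treated).  (iii) Rows at sup-depth `≥ 14L^k` below `T ∖ □`:
[7]'s *"with the same restrictions on x"* = `dist(x, Ω^c) ≥ R₀` with OUR `R₀ = 14` block units; [7]'s remark that parallelepipeds need no
restriction is NOT reproduced.  (iv) The four (H1.10″) members are HYPOTHESES at one set of constants `(c₀, δ₀)` (p31's convention; providers:
p27 `BIJ85ScalarPropagatorSupDecay.decay110_smallField_input` / `BIJ88NeumannPropagatorSmallFieldSupDecay` (values, torus/cubes), gen 25
`decay110_smallField_deriv` (derivative, `Ω = T`), p34 `BIJ88NeumannPropagatorSmallFieldCubeDeriv.decay110_smallField_cube_deriv_input`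
(derivative, cubes), p34/p27 region members); that the induction's backgrounds are plaquette-small at the block scale is p33's lane.
(v) Constants explicit in the proof, depending on `(d, L, a, c₀, δ₀)` only; no optimisation.  DIVERGENCE OF METHOD, disclosed: the print
obtains (1.11)–(1.12) inside the random-walk expansion of [7]; here it is a local interior gradient estimate plus a weighted maximum
principle for the difference of the two propagators, with our own constants and row restriction.  Kernel lemmas tagged [folklore] are real
arithmetic.  Nothing here is summit progress.  Unit `lit-balaban-p30` (literature-prover-lit-balaban-p30-g28-0), HOME
`run/shared/lean/pub/lit-balaban/`, 2026-08-23.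
-/

open scoped BigOperators ComplexConjugate
open Finset Matrix

namespace Literature.MathematicalPhysics.QuantumFieldTheory.BalabanImbrieJaffe1984to88.BIJ88NeumannPropagatorSmallFieldCloseDeriv

open Literature.MathematicalPhysics.QuantumFieldTheory.Balaban1983to89
open LatticeFieldCalculus (supDist)
open B3TorusRadialSums (supDist_comm supDist_eq_zero_iff)
open BIJ85Ineq722Torus (supDist_triangle)
open BIJ88Sect3Statements (U1 toC cfg covD norm_toC toC_one)
open BIJ88NeumannNoZeroModesTorus (IsBlockUnion)
open BIJ88NeumannPropagator227Torus (nOp gBox)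
open BIJ85ScalarPropagatorSupDecayDeriv (local_gradient_bound norm_covDiff_gaugeAct dist1_plaqHol_le_of_plaqC
  two_mul_pow_le_sitesPerDir gamma_nsq_le_one)
open BIJ85TorusTentCutoff (supDist_shift_le_one')
open BIJ85FlatPropagatorKernelDiffs (flat_kernel_diffs)
open BIJ88NeumannPropagatorSmallFieldClose (close112_smallField_of_inputs nOp_univ_diff_apply_eq_zero exists_depth depth_le_add
  mem_of_depth_pos interior_of_depth_two nOp_gaugeAct_mulVec_smul supDist_le_half)

noncomputable section

variable {P : Params}

/-! ## §1 Kernel lemmas -/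

/-- kernel: **the covariant derivative of a difference** — `covD c u φ b − covD c u φ′ b = c·(u_b(φ − φ′)(b₊) − (φ − φ′)(b₋))`.
[cite: BalabanImbrieJaffe1985, (2.3) p.302] -/
theorem covD_sub_covD (c : ℝ) (u : PBond P 0 → ℂ) (φ φ' : Balaban1983to89.Site P 0 → ℂ) (x : Balaban1983to89.Site P 0) (μ : Fin P.d) :
    covD c u φ ⟨x, μ⟩ - covD c u φ' ⟨x, μ⟩ = (c : ℂ) * (u ⟨x, μ⟩ * (φ (x.shift μ) - φ' (x.shift μ)) - (φ x - φ' x)) := by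
  simp only [covD]
  show (c : ℂ) * (u ⟨x, μ⟩ * φ (x.shift μ) - φ x) - (c : ℂ) * (u ⟨x, μ⟩ * φ' (x.shift μ) - φ' x) = _
  ring

/-- kernel: **the norm of a covariant derivative** — `‖covD ε⁻¹ u φ ⟨x,μ⟩‖ = ε⁻¹‖u_{x,μ}φ(x+e_μ) − φ(x)‖`.
[cite: BalabanImbrieJaffe1985, (2.3) p.302] -/
theorem norm_covD_apply (u : PBond P 0 → ℂ) (φ : Balaban1983to89.Site P 0 → ℂ) (x : Balaban1983to89.Site P 0) (μ : Fin P.d) :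
    ‖covD P.eps⁻¹ u φ ⟨x, μ⟩‖ = P.eps⁻¹ * ‖u ⟨x, μ⟩ * φ (x.shift μ) - φ x‖ := by
  show ‖((P.eps⁻¹ : ℝ) : ℂ) * (u ⟨x, μ⟩ * φ (x.shift μ) - φ x)‖ = _
  rw [norm_mul, Complex.norm_real, Real.norm_of_nonneg (inv_nonneg.2 P.eps_pos.le)]

/-- kernel: **the edge-alternative exponent** (pure real arithmetic): with `0 ≤ t`, `2t ≤ δ₀`, `0 ≤ A`, `Df ≤ A + δ`, `δ ≤ 14n`, `0 < n`:
`e^{−δ₀A/n} ≤ e^{28t}·e^{−t(A+δ)/n}·e^{−tDf/n}`. [folklore] -/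
private theorem exp_edge {n t δ₀ A δ Df : ℝ} (hn : 0 < n) (ht : 0 ≤ t) (htδ : 2 * t ≤ δ₀) (hA : 0 ≤ A) (hDf : Df ≤ A + δ)
    (hδ : δ ≤ 14 * n) :
    Real.exp (-(δ₀ * A / n)) ≤ Real.exp (28 * t) * Real.exp (-(t * (A + δ) / n)) * Real.exp (-(t * Df / n)) := by
  rw [← Real.exp_add, ← Real.exp_add]
  refine Real.exp_le_exp.2 ?_
  rw [show 28 * t + -(t * (A + δ) / n) + -(t * Df / n) = (28 * t * n - t * (A + δ) - t * Df) / n by field_simp; ring,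
    show -(δ₀ * A / n) = (-(δ₀ * A)) / n by ring]
  refine div_le_div_of_nonneg_right ?_ hn.le
  nlinarith [mul_le_mul_of_nonneg_left hDf ht, mul_le_mul_of_nonneg_left hδ ht, mul_nonneg ht hA]

/-- kernel: **slack of the weight over a ball**: with `0 ≤ t ≤ 1`, `A₀ ≤ s + A`, `δ₀' ≤ δ + s`, `2s ≤ n`, `0 < n`:
`e^{−t(A+δ)/n} ≤ e^{−t(A₀+δ₀')/n}·e`. [folklore] -/
private theorem exp_ball {n t A δ A₀ δ₀' s : ℝ} (hn : 0 < n) (ht : 0 ≤ t) (ht1 : t ≤ 1) (hs0 : 0 ≤ s) (hA : A₀ ≤ s + A)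
    (hδ : δ₀' ≤ δ + s) (hs : 2 * s ≤ n) :
    Real.exp (-(t * (A + δ) / n)) ≤ Real.exp (-(t * (A₀ + δ₀') / n)) * Real.exp 1 := by
  rw [← Real.exp_add]
  refine Real.exp_le_exp.2 ?_
  rw [show -(t * (A₀ + δ₀') / n) + 1 = (-(t * (A₀ + δ₀')) + n) / n by field_simp, show -(t * (A + δ) / n) = (-(t * (A + δ))) / n by ring]
  refine div_le_div_of_nonneg_right ?_ hn.le
  have h1 := mul_le_mul_of_nonneg_left hA ht
  have h2 := mul_le_mul_of_nonneg_left hδ ht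
  have h3 : t * (2 * s) ≤ 1 * (2 * s) := mul_le_mul_of_nonneg_right ht1 (by linarith)
  linarith

/-! ## §2 The covariant-derivative member of (1.11)–(1.12) at small non-flat fields -/

set_option maxHeartbeats 800000 in
/-- **[Balaban1983RegularityDecay] THEOREM p. 573, (1.11)–(1.12) — THE `δG_k(□,Ω)` COVARIANT-DERIVATIVE MEMBER AT SMALL NON-FLAT `U(1)` FIELDS,
`k`-UNIFORM, OPERATOR FORM**: *"If Ω ⊂ Ω₀, then for δG_k(Ω,Ω₀,A) = G_k(Ω,A) − G_k(Ω₀,A) we have the inequalities (1.5) and (1.6) (with the same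
restrictions on x, x′) with the additional factor (1.12) [= exp(−δ₀dist(x, Ω^c))exp(−δ₀dist(supp f, Ω^c))] on the right hand sides"* — the
`D^η_{A,μ}` half of (1.5)/(1.10) —, for [BalabanImbrieJaffe1985] p. 326 *"The propagators arising from Δ_k(u_k) … also satisfy the regularity
and decay estimates of [7]"*, here for p31's region Neumann propagators `G_k(X,u) = gBox (α_kL^{kd}) ε⁻¹ u k X` on NESTED k-BLOCK UNIONS
`□ ⊆ Ω` of the torus: rows `x ∈ □` at sup-depth `≥ 14L^k` below `T ∖ □`; `F = ‖f‖_∞`, `f` supported in `□`, `D ≤ dist(x, supp f)`,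
`D_b ≤ dist(x, □^c)`, `D_f ≤ dist(supp f, □^c)`; bound `(L^kε)·c₂e^{−δ₂D/L^k}e^{−δ₂(D_b+D_f)/L^k}F` on
`‖covD ε⁻¹ u (G_k(□,u)f) ⟨x,μ⟩ − covD ε⁻¹ u (G_k(Ω,u)f) ⟨x,μ⟩‖`, FROM the (H1.10″) value members of `G_k(□,u)`, `G_k(Ω,u)` on the rows of
`□` and their (H1.10″) covariant-derivative members on the rows `x` of `□` with `{|x − ·|_∞ < L^k} ⊆ □` (four hypotheses at one set of
constants `(c₀, δ₀)`; p27's torus/cube members, gen 25's torus derivative member, p34's cube/region members instantiate them) and block-scale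
plaquette smallness `|u(∂p) − 1| ≤ θ`, `2d³(L^{2k}θ)² ≤ 1`: for `2 ≤ d ≤ 3`, `L` odd `> 1`, `a > 0`, `c₀ ≥ 0`, `δ₀ > 0` there are `c₂, δ₂ > 0`
depending on `(d, L, a, c₀, δ₀)` only.  METHOD (ours — the print extends [7]'s random-walk expansion): gen 25's local interior gradient
estimate `local_gradient_bound` at the maximal bond of a weighted maximum over the deep bonds, values from gen 27's
`close112_smallField_of_inputs`, covariant differences on the collar of the deep region from the two derivative members, absorption
`C_L(d−1)θr²e ≤ ½` with `r = ⌊cL^k⌋`.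
[cite: Balaban1983RegularityDecay, Theorem p.573 (1.10)–(1.12)] [cite: BalabanImbrieJaffe1985, (7.3.1) p.326, (4.6.2) p.313]
[cite: BalabanImbrieJaffe1988, (2.31) p.263] -/
theorem close112_smallField_deriv_of_inputs (d L : ℕ) (hd : 2 ≤ d) (hd3 : d ≤ 3) (hL : Odd L ∧ 1 < L) {a : ℝ} (ha : 0 < a)
    {c₀ δ₀ : ℝ} (hc₀ : 0 ≤ c₀) (hδ₀ : 0 < δ₀) :
    ∃ c₂ δ₂ : ℝ, 0 < c₂ ∧ 0 < δ₂ ∧ ∀ (P : Params), P.d = d → P.L = L → ∀ k : ℕ, 1 ≤ k → k ≤ P.K →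
      ∀ (U : GaugeField P 0 U1) (θ : ℝ), (∀ (y : Balaban1983to89.Site P 0) (μ ν : Fin P.d), ‖BIJ85AbelianStokes.plaqC U y μ ν - 1‖ ≤ θ) →
      2 * (P.d : ℝ) ^ 3 * (((P.L : ℝ) ^ k) ^ 2 * θ) ^ 2 ≤ 1 →
      ∀ (B Ω : Finset (Balaban1983to89.Site P 0)), IsBlockUnion k B → IsBlockUnion k Ω → B ⊆ Ω →
      (∀ x ∈ B, ∀ (f : Balaban1983to89.Site P 0 → ℂ) (F D : ℝ), (∀ y, ‖f y‖ ≤ F) → 0 ≤ D →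
          (∀ y, f y ≠ 0 → D ≤ B5Ineq137Torus.T P 0 x y) →
          ‖(gBox (B1RG242Torus.α P a k * (P.L : ℝ) ^ (k * P.d)) P.eps⁻¹ U k B *ᵥ f) x‖ ≤
            P.spacing k ^ 2 * (c₀ * Real.exp (-(δ₀ * (((P.L : ℝ) ^ k)⁻¹ * D))) * F)) →
      (∀ x ∈ B, ∀ (f : Balaban1983to89.Site P 0 → ℂ) (F D : ℝ), (∀ y, ‖f y‖ ≤ F) → 0 ≤ D →
          (∀ y, f y ≠ 0 → D ≤ B5Ineq137Torus.T P 0 x y) →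
          ‖(gBox (B1RG242Torus.α P a k * (P.L : ℝ) ^ (k * P.d)) P.eps⁻¹ U k Ω *ᵥ f) x‖ ≤
            P.spacing k ^ 2 * (c₀ * Real.exp (-(δ₀ * (((P.L : ℝ) ^ k)⁻¹ * D))) * F)) →
      (∀ x, (∀ y, B5Ineq137Torus.T P 0 x y < (P.L : ℝ) ^ k → y ∈ B) →
          ∀ (f : Balaban1983to89.Site P 0 → ℂ) (F D : ℝ), (∀ y, ‖f y‖ ≤ F) → 0 ≤ D →
          (∀ y, f y ≠ 0 → D ≤ B5Ineq137Torus.T P 0 x y) → ∀ (μ : Fin P.d),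
          ‖covD P.eps⁻¹ (cfg U) (gBox (B1RG242Torus.α P a k * (P.L : ℝ) ^ (k * P.d)) P.eps⁻¹ U k B *ᵥ f) ⟨x, μ⟩‖ ≤
            P.spacing k * (c₀ * Real.exp (-(δ₀ * (((P.L : ℝ) ^ k)⁻¹ * D))) * F)) →
      (∀ x, (∀ y, B5Ineq137Torus.T P 0 x y < (P.L : ℝ) ^ k → y ∈ B) →
          ∀ (f : Balaban1983to89.Site P 0 → ℂ) (F D : ℝ), (∀ y, ‖f y‖ ≤ F) → 0 ≤ D →
          (∀ y, f y ≠ 0 → D ≤ B5Ineq137Torus.T P 0 x y) → ∀ (μ : Fin P.d),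
          ‖covD P.eps⁻¹ (cfg U) (gBox (B1RG242Torus.α P a k * (P.L : ℝ) ^ (k * P.d)) P.eps⁻¹ U k Ω *ᵥ f) ⟨x, μ⟩‖ ≤
            P.spacing k * (c₀ * Real.exp (-(δ₀ * (((P.L : ℝ) ^ k)⁻¹ * D))) * F)) →
      ∀ x ∈ B, (∀ w, w ∉ B → 14 * (P.L : ℝ) ^ k ≤ B5Ineq137Torus.T P 0 x w) →
      ∀ (f : Balaban1983to89.Site P 0 → ℂ) (F D Db Df : ℝ), (∀ y, ‖f y‖ ≤ F) → (∀ y, y ∉ B → f y = 0) →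
        0 ≤ D → (∀ y, f y ≠ 0 → D ≤ B5Ineq137Torus.T P 0 x y) → 0 ≤ Db → (∀ w, w ∉ B → Db ≤ B5Ineq137Torus.T P 0 x w) →
        0 ≤ Df → (∀ y, f y ≠ 0 → ∀ w, w ∉ B → Df ≤ B5Ineq137Torus.T P 0 y w) → ∀ (μ : Fin P.d),
        ‖covD P.eps⁻¹ (cfg U) (gBox (B1RG242Torus.α P a k * (P.L : ℝ) ^ (k * P.d)) P.eps⁻¹ U k B *ᵥ f) ⟨x, μ⟩ -
            covD P.eps⁻¹ (cfg U) (gBox (B1RG242Torus.α P a k * (P.L : ℝ) ^ (k * P.d)) P.eps⁻¹ U k Ω *ᵥ f) ⟨x, μ⟩‖ ≤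
          P.spacing k * (c₂ * Real.exp (-(δ₂ * (((P.L : ℝ) ^ k)⁻¹ * D))) *
            Real.exp (-(δ₂ * (((P.L : ℝ) ^ k)⁻¹ * (Db + Df)))) * F) := by
  classical
  obtain ⟨c₁, δ₁, hc₁, hδ₁, hval⟩ := close112_smallField_of_inputs d L hd hd3 hL ha hc₀ hδ₀
  obtain ⟨C_K, hCK, hker⟩ := flat_kernel_diffs d L hd hL ha (le_refl (0 : ℝ))
  obtain ⟨C_L, hCL, hloc⟩ := local_gradient_bound d (by omega) C_K hCK.le
  -- the rate, the ball fraction and the constant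
  set t : ℝ := min (min δ₁ (δ₀ / 2)) 1 with htdef
  have ht : 0 < t := lt_min (lt_min hδ₁ (by linarith)) one_pos
  have ht1 : t ≤ 1 := min_le_right _ _
  have htδ₁ : t ≤ δ₁ := (min_le_left _ _).trans (min_le_left _ _)
  have htδ₀ : 2 * t ≤ δ₀ := by
    have h1 : t ≤ min δ₁ (δ₀ / 2) := min_le_left _ _
    have h2 : min δ₁ (δ₀ / 2) ≤ δ₀ / 2 := min_le_right _ _
    linarith
  set e : ℝ := Real.exp 1 with hedef
  have he1 : 1 ≤ e := by rw [hedef]; exact Real.one_le_exp (by norm_num)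
  have he0 : 0 < e := Real.exp_pos 1
  set c : ℝ := min (1 / 8) (1 / (2 * (C_L * e + 1))) with hcdef
  have hc0 : 0 < c := lt_min (by norm_num) (by positivity)
  have hc8 : c ≤ 1 / 8 := min_le_left _ _
  have hc1 : c ≤ 1 := hc8.trans (by norm_num)
  have hcC : C_L * e * c ≤ 1 / 2 := by
    have h1 : c ≤ 1 / (2 * (C_L * e + 1)) := min_le_right _ _
    have h2 : 0 ≤ C_L * e := by positivity
    calc C_L * e * c ≤ C_L * e * (1 / (2 * (C_L * e + 1))) := mul_le_mul_of_nonneg_left h1 h2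
      _ ≤ 1 / 2 := by rw [mul_one_div, div_le_iff₀ (by positivity)]; linarith
  set K₁ : ℝ := c₁ * Real.exp 6 * (c + 2 / c + 2 * a) with hK₁
  have hK₁0 : 0 ≤ K₁ := by positivity
  refine ⟨2 * C_L * K₁ + 2 * Real.exp 29 * c₀ + 8 * e ^ 2 * c₁ / c + 1, t, by positivity, ht, ?_⟩
  intro P hPd hPL k hk1 hkK U θ hθ hsmall B Ω hB hΩ hsub hGB hGΩ hDB hDΩ x hxB hdeep f F D Db Df hF hfB hD hsD hDb hsDb hDf hsDf μ
  have hvalP := hval P hPd hPL k hk1 hkK U θ hθ hsmall B Ω hB hΩ hsub hGB hGΩ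
  have hkerP := hker P hPd hPL k hk1 hkK
  subst hPd
  -- basic quantities
  have hd1 : 1 ≤ P.d := by omega
  have hk : k ≤ P.m + P.K := hkK.trans (Nat.le_add_left _ _)
  have hk0 : 0 + k ≤ P.m + P.K := by omega
  have hLpos : (0 : ℝ) < P.L := P.cast_L_pos
  have hL1 : (1 : ℝ) < P.L := B1RG242Torus.one_lt_cast_L P
  have hε : 0 < P.eps := P.eps_pos
  set n : ℝ := (P.L : ℝ) ^ k with hndef
  have hn : 0 < n := pow_pos hLpos k
  have hn1 : 1 ≤ n := one_le_pow₀ hL1.le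
  have hncast : ((P.L ^ k : ℕ) : ℝ) = n := by rw [hndef]; exact Nat.cast_pow P.L k
  have hsp : P.spacing k = n * P.eps := rfl
  have hsp0 : 0 < P.spacing k := P.spacing_pos k
  have hα : 0 < B1RG242Torus.α P a k := mul_pos (B1.aSeq_pos ha hL1 hk1) (inv_pos.2 (pow_pos hsp0 2))
  have hαa : B1RG242Torus.α P a k * P.spacing k ^ 2 ≤ a := by
    show B1.aSeq a P.L k * (P.spacing k ^ 2)⁻¹ * P.spacing k ^ 2 ≤ a
    rw [inv_mul_cancel_right₀ (pow_ne_zero 2 hsp0.ne')]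
    exact B1.aSeq_le ha hL1 k hk1
  set a' : ℝ := B1RG242Torus.α P a k * (P.L : ℝ) ^ (k * P.d) with ha'def
  have ha' : 0 < a' := mul_pos hα (pow_pos hLpos _)
  have hc' : P.eps⁻¹ ≠ 0 := inv_ne_zero hε.ne'
  have hθ0 : 0 ≤ θ := (norm_nonneg _).trans (hθ x μ μ)
  have hF0 : 0 ≤ F := (norm_nonneg _).trans (hF x)
  have hT : ∀ y z : Balaban1983to89.Site P 0, B5Ineq137Torus.T P 0 y z = (supDist y z : ℝ) :=
    fun y z => B3Bound323ZeroTorus.T_eq_supDist P y z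
  -- the function `v` and the target
  set v : Balaban1983to89.Site P 0 → ℂ := fun y => (gBox a' P.eps⁻¹ U k B *ᵥ f) y - (gBox a' P.eps⁻¹ U k Ω *ᵥ f) y with hv
  set X : ℝ := Real.exp (-(t * Df / n)) with hXdef
  have hX0 : 0 < X := Real.exp_pos _
  have hX1 : X ≤ 1 := by rw [hXdef]; exact Real.exp_le_one_iff.2 (by rw [neg_nonpos]; positivity)
  have hexpD : ∀ {D₁ D₂ : ℝ}, D₂ ≤ D₁ → Real.exp (-(t * D₁ / n)) ≤ Real.exp (-(t * D₂ / n)) := fun h =>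
    Real.exp_le_exp.2 (by rw [neg_le_neg_iff]; exact div_le_div_of_nonneg_right (mul_le_mul_of_nonneg_left h ht.le) hn.le)
  have hexp_δ₁ : ∀ {D' : ℝ}, 0 ≤ D' → Real.exp (-(δ₁ * (n⁻¹ * D'))) ≤ Real.exp (-(t * D' / n)) := fun {D'} hD' => by
    refine Real.exp_le_exp.2 ?_
    rw [show δ₁ * (n⁻¹ * D') = δ₁ * D' / n by ring, neg_le_neg_iff]
    exact div_le_div_of_nonneg_right (mul_le_mul_of_nonneg_right htδ₁ hD') hn.le
  have hgoal : ‖covD P.eps⁻¹ (cfg U) (gBox a' P.eps⁻¹ U k B *ᵥ f) ⟨x, μ⟩ - covD P.eps⁻¹ (cfg U) (gBox a' P.eps⁻¹ U k Ω *ᵥ f) ⟨x, μ⟩‖ =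
      P.eps⁻¹ * ‖cfg U ⟨x, μ⟩ * v (x.shift μ) - v x‖ := by
    rw [covD_sub_covD, norm_mul, Complex.norm_real, Real.norm_of_nonneg (inv_nonneg.2 hε.le)]
  rw [hgoal, show t * (n⁻¹ * D) = t * D / n by ring, show t * (n⁻¹ * (Db + Df)) = t * Db / n + t * Df / n by ring, neg_add,
    Real.exp_add, ← hXdef]
  set c₂ : ℝ := 2 * C_L * K₁ + 2 * Real.exp 29 * c₀ + 8 * e ^ 2 * c₁ / c + 1 with hc₂def
  have hc₂a : 2 * C_L * K₁ + 2 * Real.exp 29 * c₀ ≤ c₂ := by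
    rw [hc₂def]; linarith [show (0 : ℝ) ≤ 8 * e ^ 2 * c₁ / c by positivity]
  have hc₂b : 8 * e ^ 2 * c₁ / c ≤ c₂ := by
    rw [hc₂def]; linarith [show (0 : ℝ) ≤ 2 * C_L * K₁ + 2 * Real.exp 29 * c₀ by positivity]
  -- the trivial case `□ = T`
  by_cases hBT : B = univ
  · have hΩT : Ω = univ := Finset.eq_univ_of_forall fun y => hsub (hBT ▸ mem_univ y)
    have h0 : ∀ y, v y = 0 := fun y => by
      show (gBox _ _ U k B *ᵥ f) y - (gBox _ _ U k Ω *ᵥ f) y = 0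
      rw [hBT, hΩT, sub_self]
    rw [h0, h0, mul_zero, sub_zero, norm_zero, mul_zero]; positivity
  -- the depth function; the row `x` is deep; the torus is large
  obtain ⟨δB, h1, h2⟩ := exists_depth hBT
  obtain ⟨w₀, hw₀, hδx⟩ := h2 x
  have hδx14 : 14 * P.L ^ k ≤ δB x := by
    have hh := hdeep w₀ hw₀
    rw [hT, ← hδx] at hh
    have h3 : ((14 * P.L ^ k : ℕ) : ℝ) ≤ ((δB x : ℕ) : ℝ) := by push_cast; linarith [hh, hndef]
    exact_mod_cast h3
  have hNbig : 28 * P.L ^ k ≤ P.sitesPerDir 0 := by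
    have h3 := supDist_le_half x w₀
    rw [← hδx] at h3
    omega
  have hr1L : 1 ≤ P.L ^ k := Nat.one_le_pow _ _ P.L_pos
  -- harmonicity of `v` at depth `≥ 2`
  have hharm : ∀ y, 2 ≤ δB y → (nOp a' P.eps⁻¹ U k univ *ᵥ v) y = 0 := by
    intro y hy
    obtain ⟨hyB, hs, hu⟩ := interior_of_depth_two h1 h2 hy
    exact nOp_univ_diff_apply_eq_zero hk0 hc' ha' U hB hΩ hsub f hyB hs hu
  -- `dist(supp f, □^c) ≤ dist(z, supp f) + depth(z)` in the form used below, and the depth from `hdeep`-type data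
  have hDf_edge : ∀ (z y : Balaban1983to89.Site P 0), f y ≠ 0 → Df ≤ (supDist z y : ℝ) + δB z := by
    intro z y hy
    obtain ⟨w, hw, hzw⟩ := h2 z
    have := hsDf y hy w hw
    rw [hT] at this
    have htri : supDist y w ≤ supDist y z + supDist z w := supDist_triangle y z w
    have hc : ((supDist y w : ℕ) : ℝ) ≤ ((supDist y z + supDist z w : ℕ) : ℝ) := by exact_mod_cast htri
    push_cast at hc
    rw [supDist_comm y z, ← hzw] at hc
    linarith
  -- THE VALUE MEMBER near a deep row: for `z` with `|y₀ − z|_∞ ≤ s`, `depth(y₀) ≥ 14L^k`, `s ≤ 4L^k`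
  have hvalue : ∀ (y₀ z : Balaban1983to89.Site P 0) (s : ℕ), 14 * P.L ^ k ≤ δB y₀ → supDist y₀ z ≤ s → s ≤ 4 * P.L ^ k →
      ∀ A₀ : ℝ, (∀ y, f y ≠ 0 → A₀ ≤ (supDist y₀ y : ℝ)) →
      ‖v z‖ ≤ c₁ * P.spacing k ^ 2 * F * (Real.exp (-(t * (A₀ - s) / n)) * Real.exp (-(t * ((δB y₀ : ℝ) - s) / n))) * X := by
    intro y₀ z s hy₀ hz hs A₀ hA₀
    have hzB : z ∈ B := mem_of_depth_pos h1 (by have := depth_le_add h1 h2 y₀ z; omega)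
    have hz10 : ∀ w, w ∉ B → 10 * n ≤ B5Ineq137Torus.T P 0 z w := by
      intro w hw
      have h3 := h1 y₀ w hw
      have h4 := supDist_triangle y₀ z w
      have h5 : 10 * P.L ^ k ≤ supDist z w := by omega
      have h6 : ((10 * P.L ^ k : ℕ) : ℝ) ≤ ((supDist z w : ℕ) : ℝ) := by exact_mod_cast h5
      rw [hT]; push_cast at h6; linarith [h6, hndef]
    have hsup1 : ∀ y, f y ≠ 0 → max (A₀ - s) 0 ≤ B5Ineq137Torus.T P 0 z y := by
      intro y hy
      rw [hT]; refine max_le ?_ (Nat.cast_nonneg _)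
      have h3 := hA₀ y hy
      have h4 : supDist y₀ y ≤ supDist y₀ z + supDist z y := supDist_triangle y₀ z y
      have h5 : ((supDist y₀ y : ℕ) : ℝ) ≤ ((supDist y₀ z + supDist z y : ℕ) : ℝ) := by exact_mod_cast h4
      have h6 : ((supDist y₀ z : ℕ) : ℝ) ≤ s := by exact_mod_cast hz
      push_cast at h5; linarith
    have hsup2 : ∀ w, w ∉ B → max ((δB y₀ : ℝ) - s) 0 ≤ B5Ineq137Torus.T P 0 z w := by
      intro w hw
      rw [hT]; refine max_le ?_ (Nat.cast_nonneg _)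
      have h3 := h1 y₀ w hw
      have h4 : supDist y₀ w ≤ supDist y₀ z + supDist z w := supDist_triangle y₀ z w
      have h5 : ((δB y₀ : ℕ) : ℝ) ≤ ((supDist y₀ z + supDist z w : ℕ) : ℝ) := by exact_mod_cast h3.trans h4
      have h6 : ((supDist y₀ z : ℕ) : ℝ) ≤ s := by exact_mod_cast hz
      push_cast at h5; linarith
    have hm := hvalP z hzB hz10 f F (max (A₀ - s) 0) (max ((δB y₀ : ℝ) - s) 0) Df hF hfB (le_max_right _ _) hsup1 (le_max_right _ _)
      hsup2 hDf hsDf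
    refine hm.trans ?_
    have e1 : Real.exp (-(δ₁ * (n⁻¹ * max (A₀ - s) 0))) ≤ Real.exp (-(t * (A₀ - s) / n)) :=
      (hexp_δ₁ (le_max_right _ _)).trans (hexpD (le_max_left _ _))
    have e2 : Real.exp (-(δ₁ * (n⁻¹ * (max ((δB y₀ : ℝ) - s) 0 + Df)))) ≤
        Real.exp (-(t * ((δB y₀ : ℝ) - s) / n)) * X := by
      rw [show δ₁ * (n⁻¹ * (max ((δB y₀ : ℝ) - s) 0 + Df)) =
          δ₁ * (n⁻¹ * max ((δB y₀ : ℝ) - s) 0) + δ₁ * (n⁻¹ * Df) by ring, neg_add, Real.exp_add, hXdef]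
      exact mul_le_mul ((hexp_δ₁ (le_max_right _ _)).trans (hexpD (le_max_left _ _))) (hexp_δ₁ hDf) (Real.exp_pos _).le
        (Real.exp_pos _).le
    have e3 := mul_le_mul e1 e2 (by positivity) (by positivity)
    calc P.spacing k ^ 2 * (c₁ * Real.exp (-(δ₁ * (n⁻¹ * max (A₀ - ↑s) 0))) *
          Real.exp (-(δ₁ * (n⁻¹ * (max ((δB y₀ : ℝ) - s) 0 + Df)))) * F)
        = (P.spacing k ^ 2 * c₁ * F) * (Real.exp (-(δ₁ * (n⁻¹ * max (A₀ - ↑s) 0))) *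
          Real.exp (-(δ₁ * (n⁻¹ * (max ((δB y₀ : ℝ) - s) 0 + Df))))) := by ring
      _ ≤ (P.spacing k ^ 2 * c₁ * F) * (Real.exp (-(t * (A₀ - s) / n)) * (Real.exp (-(t * ((δB y₀ : ℝ) - s) / n)) * X)) :=
          mul_le_mul_of_nonneg_left e3 (by positivity)
      _ = _ := by ring
  ----------------------------------------------------------------------------------------------------------------
  -- the radius of the interior estimate
  set r : ℕ := ⌊c * n⌋₊ with hrdef
  have hrc : (r : ℝ) ≤ c * n := Nat.floor_le (by positivity)
  by_cases hr4 : r < 4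
  · ----------------------------------------------------------------------------------------------------------------
    -- SMALL CASE `cL^k < 4`: the trivial bound by two values of `v`
    have hn4 : n < 4 / c := by
      have h3 : c * n < r + 1 := Nat.lt_floor_add_one _
      have h4 : (r : ℝ) + 1 ≤ 4 := by exact_mod_cast hr4
      rw [lt_div_iff₀ hc0]; linarith
    have hsD' : ∀ y, f y ≠ 0 → D ≤ (supDist x y : ℝ) := fun y hy => by rw [← hT]; exact hsD y hy
    have hDbx : Db ≤ (δB x : ℝ) := by have := hsDb w₀ hw₀; rwa [hT, ← hδx] at this
    have hvx := hvalue x x 0 hδx14 (le_of_eq ((supDist_eq_zero_iff x x).2 rfl)) (Nat.zero_le _) D hsD'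
    have hvx' := hvalue x (x.shift μ) 1 hδx14 (supDist_shift_le_one' x μ) (by omega) D hsD'
    have hEx : Real.exp (-(t * (D - (0 : ℕ)) / n)) * Real.exp (-(t * ((δB x : ℝ) - (0 : ℕ)) / n)) ≤
        Real.exp (-(t * D / n)) * Real.exp (-(t * Db / n)) := by
      rw [Nat.cast_zero, sub_zero, sub_zero]
      exact mul_le_mul_of_nonneg_left (hexpD hDbx) (Real.exp_pos _).le
    have hEx' : Real.exp (-(t * (D - (1 : ℕ)) / n)) * Real.exp (-(t * ((δB x : ℝ) - (1 : ℕ)) / n)) ≤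
        e ^ 2 * (Real.exp (-(t * D / n)) * Real.exp (-(t * Db / n))) := by
      rw [Nat.cast_one]
      have htn : t / n ≤ 1 := by rw [div_le_one hn]; exact ht1.trans hn1
      have q1 : Real.exp (-(t * (D - 1) / n)) ≤ e * Real.exp (-(t * D / n)) := by
        rw [hedef, ← Real.exp_add]; refine Real.exp_le_exp.2 ?_
        rw [show -(t * (D - 1) / n) = -(t * D / n) + t / n by ring]; linarith
      have q2 : Real.exp (-(t * ((δB x : ℝ) - 1) / n)) ≤ e * Real.exp (-(t * Db / n)) := by
        refine (hexpD (show Db - 1 ≤ (δB x : ℝ) - 1 by linarith)).trans ?_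
        rw [hedef, ← Real.exp_add]; refine Real.exp_le_exp.2 ?_
        rw [show -(t * (Db - 1) / n) = -(t * Db / n) + t / n by ring]; linarith
      calc _ ≤ (e * Real.exp (-(t * D / n))) * (e * Real.exp (-(t * Db / n))) :=
            mul_le_mul q1 q2 (Real.exp_pos _).le (by positivity)
        _ = _ := by ring
    set EXP : ℝ := Real.exp (-(t * D / n)) * Real.exp (-(t * Db / n)) with hEXP
    have hEXP0 : 0 ≤ EXP := by positivity
    have hδ : ‖cfg U ⟨x, μ⟩ * v (x.shift μ) - v x‖ ≤ 2 * e ^ 2 * c₁ * P.spacing k ^ 2 * F * EXP * X := by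
      refine (norm_sub_le _ _).trans ?_
      rw [norm_mul, show ‖cfg U ⟨x, μ⟩‖ = 1 from norm_toC _, one_mul]
      have b1 : ‖v x‖ ≤ c₁ * P.spacing k ^ 2 * F * EXP * X :=
        hvx.trans (mul_le_mul_of_nonneg_right (mul_le_mul_of_nonneg_left hEx (by positivity)) hX0.le)
      have b2 : ‖v (x.shift μ)‖ ≤ c₁ * P.spacing k ^ 2 * F * (e ^ 2 * EXP) * X :=
        hvx'.trans (mul_le_mul_of_nonneg_right (mul_le_mul_of_nonneg_left hEx' (by positivity)) hX0.le)
      have b3 : c₁ * P.spacing k ^ 2 * F * EXP * X ≤ c₁ * P.spacing k ^ 2 * F * (e ^ 2 * EXP) * X := by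
        have : EXP ≤ e ^ 2 * EXP := le_mul_of_one_le_left hEXP0 (one_le_pow₀ he1)
        gcongr
      linarith
    calc P.eps⁻¹ * ‖cfg U ⟨x, μ⟩ * v (x.shift μ) - v x‖ ≤ P.eps⁻¹ * (2 * e ^ 2 * c₁ * P.spacing k ^ 2 * F * EXP * X) :=
          mul_le_mul_of_nonneg_left hδ (inv_nonneg.2 hε.le)
      _ = (2 * e ^ 2 * c₁ * n) * P.spacing k * F * EXP * X := by rw [hsp]; field_simp
      _ ≤ (8 * e ^ 2 * c₁ / c) * P.spacing k * F * EXP * X := by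
          have : 2 * e ^ 2 * c₁ * n ≤ 8 * e ^ 2 * c₁ / c := by
            rw [show 8 * e ^ 2 * c₁ / c = 2 * e ^ 2 * c₁ * (4 / c) by ring]
            exact mul_le_mul_of_nonneg_left hn4.le (by positivity)
          gcongr
      _ ≤ c₂ * P.spacing k * F * EXP * X :=
          mul_le_mul_of_nonneg_right (mul_le_mul_of_nonneg_right (mul_le_mul_of_nonneg_right
            (mul_le_mul_of_nonneg_right hc₂b hsp0.le) hF0) hEXP0) hX0.le
      _ = P.spacing k * (c₂ * Real.exp (-(t * D / n)) * (Real.exp (-(t * Db / n)) * X) * F) := by rw [hEXP]; ring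
  ----------------------------------------------------------------------------------------------------------------
  -- MAIN CASE `r = ⌊cL^k⌋ ≥ 4`
  push Not at hr4
  have hr1 : 1 ≤ r := by omega
  have hr0 : (0 : ℝ) < r := by exact_mod_cast (show 0 < r by omega)
  have hcn4 : 4 ≤ c * n := le_trans (by exact_mod_cast hr4) hrc
  have hr2 : c * n / 2 ≤ r := by have h3 : c * n < r + 1 := Nat.lt_floor_add_one _; linarith
  have hrn : (r : ℝ) ≤ n / 8 := hrc.trans (by nlinarith)
  have hrn' : 8 * r ≤ P.L ^ k := by
    have h3 : 8 * (r : ℝ) ≤ (P.L ^ k : ℕ) := by rw [hncast]; linarith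
    exact_mod_cast h3
  have hN : 4 * r + 6 ≤ P.sitesPerDir 0 := by omega
  -- the trivial sub-case `f = 0`
  by_cases hf0 : ∀ z, f z = 0
  · have hv0 : ∀ y, v y = 0 := fun y => by
      show (gBox _ _ U k B *ᵥ f) y - (gBox _ _ U k Ω *ᵥ f) y = 0
      rw [show f = 0 from funext hf0, mulVec_zero, mulVec_zero, Pi.zero_apply, sub_self]
    rw [hv0, hv0, mul_zero, sub_zero, norm_zero, mul_zero]; positivity
  push Not at hf0
  -- the distance to the support
  set supp : Finset (Balaban1983to89.Site P 0) := univ.filter fun w => f w ≠ 0 with hsuppdef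
  have hne : supp.Nonempty := by obtain ⟨w, hw⟩ := hf0; exact ⟨w, by rw [hsuppdef, mem_filter]; exact ⟨mem_univ _, hw⟩⟩
  have hmem : ∀ {w}, f w ≠ 0 → w ∈ supp := fun hw => by rw [hsuppdef, mem_filter]; exact ⟨mem_univ _, hw⟩
  set Dst : Balaban1983to89.Site P 0 → ℕ := fun z => supp.inf' hne fun w => supDist z w with hDst
  have hDst_le : ∀ z w, f w ≠ 0 → Dst z ≤ supDist z w := fun z w hw => Finset.inf'_le _ (hmem hw)
  have hDst_ex : ∀ z, ∃ w, f w ≠ 0 ∧ Dst z = supDist z w := fun z => by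
    obtain ⟨w, hw, h⟩ := Finset.exists_mem_eq_inf' hne (fun w => supDist z w)
    rw [hsuppdef, mem_filter] at hw
    exact ⟨w, hw.2, h⟩
  have hDst_tri : ∀ y z, Dst y ≤ supDist y z + Dst z := fun y z => by
    obtain ⟨w, hw, h⟩ := hDst_ex z
    rw [h]
    exact (hDst_le y w hw).trans (supDist_triangle y z w)
  -- the weighted maximum over the deep bonds
  set Z : Finset (PBond P 0) := univ.filter fun b => 14 * P.L ^ k ≤ δB b.src with hZdef
  have hmemZ : ∀ b : PBond P 0, b ∈ Z ↔ 14 * P.L ^ k ≤ δB b.src := fun b => by rw [hZdef, mem_filter]; simp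
  have hxZ : (⟨x, μ⟩ : PBond P 0) ∈ Z := (hmemZ _).2 hδx14
  set g : PBond P 0 → ℝ := fun b => Real.exp (t * ((Dst b.src : ℝ) + δB b.src) / n) * ‖cfg U b * v b.tgt - v b.src‖ with hgdef
  obtain ⟨b₀, hb₀Z, hb₀⟩ := exists_max_image Z g ⟨⟨x, μ⟩, hxZ⟩
  set M : ℝ := g b₀ with hMdef
  have hMb : ∀ b ∈ Z, g b ≤ M := fun b hb => hb₀ b hb
  have hM0 : 0 ≤ M := le_trans (by positivity) (hMb ⟨x, μ⟩ hxZ)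
  have hMuse : ∀ (z : Balaban1983to89.Site P 0) (ν : Fin P.d), 14 * P.L ^ k ≤ δB z →
      ‖cfg U ⟨z, ν⟩ * v (z.shift ν) - v z‖ ≤ M * Real.exp (-(t * ((Dst z : ℝ) + δB z) / n)) := by
    intro z ν hz
    have q1 := hMb ⟨z, ν⟩ ((hmemZ _).2 hz)
    simp only [hgdef] at q1
    have q2 : Real.exp (t * ((Dst z : ℝ) + δB z) / n) * Real.exp (-(t * ((Dst z : ℝ) + δB z) / n)) = 1 := by
      rw [← Real.exp_add, add_neg_cancel, Real.exp_zero]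
    calc ‖cfg U ⟨z, ν⟩ * v (z.shift ν) - v z‖
        = (Real.exp (t * ((Dst z : ℝ) + δB z) / n) * ‖cfg U ⟨z, ν⟩ * v (z.shift ν) - v z‖) *
            Real.exp (-(t * ((Dst z : ℝ) + δB z) / n)) := by rw [mul_comm (Real.exp _), mul_assoc, q2, mul_one]
      _ ≤ M * Real.exp (-(t * ((Dst z : ℝ) + δB z) / n)) := mul_le_mul_of_nonneg_right q1 (Real.exp_pos _).le
  ----------------------------------------------------------------------------------------------------------------
  -- THE ABSORPTION STEP at the maximal bond `b₀ = ⟨y₀, μ₀⟩`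
  obtain ⟨y₀, μ₀⟩ := b₀
  have hy₀ : 14 * P.L ^ k ≤ δB y₀ := (hmemZ _).1 hb₀Z
  set E : ℝ := Real.exp (-(t * ((Dst y₀ : ℝ) + δB y₀) / n)) with hEdef
  have hE0 : 0 < E := Real.exp_pos _
  have hEinv : Real.exp (t * ((Dst y₀ : ℝ) + δB y₀) / n) * E = 1 := by rw [hEdef, ← Real.exp_add, add_neg_cancel, Real.exp_zero]
  -- the gauge
  set hg := BIJ85CentredAxialGauge.centredGauge U y₀ (2 * r) with hhg
  set U' := GaugeField.gaugeAct hg U with hU'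
  set ψ : Balaban1983to89.Site P 0 → ℂ := fun z => toC (hg z) * v z with hψdef
  set f' : Balaban1983to89.Site P 0 → ℂ := nOp a' P.eps⁻¹ U' k univ *ᵥ ψ with hf'def
  have hψeq : nOp a' P.eps⁻¹ U' k univ *ᵥ ψ = f' := rfl
  have hnormψ : ∀ z, ‖ψ z‖ = ‖v z‖ := fun z => by simp only [hψdef]; rw [norm_mul, norm_toC, one_mul]
  have hcov : ∀ z ν, ‖cfg U' ⟨z, ν⟩ * ψ (z.shift ν) - ψ z‖ = ‖cfg U ⟨z, ν⟩ * v (z.shift ν) - v z‖ := fun z ν =>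
    norm_covDiff_gaugeAct hg U v z ν
  set γ : ℝ := ((P.d - 1 : ℕ) : ℝ) * θ with hγdef
  have hγ0 : 0 ≤ γ := by positivity
  have hγn : γ * n ^ 2 ≤ 1 := gamma_nsq_le_one hθ0 hd1 hsmall
  have hgauge : ∀ z ν, supDist y₀ z ≤ 2 * r → ‖cfg U' ⟨z, ν⟩ - 1‖ ≤ γ * supDist y₀ z := by
    intro z ν hz
    have hR : 2 * (2 * r) + 4 < P.sitesPerDir 0 := by omega
    have q1 := BIJ85CentredAxialGauge.dist1_centredGauge_le U hθ0 (dist1_plaqHol_le_of_plaqC U hθ) y₀ hR z hz ν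
    rw [BIJ88Smooth43Axial.dist1_eq_norm_toC_sub_one] at q1
    calc ‖cfg U' ⟨z, ν⟩ - 1‖ = ‖toC (GaugeField.gaugeAct hg U ⟨z, ν⟩) - 1‖ := rfl
      _ ≤ ((P.d - 1 : ℕ) : ℝ) * (supDist y₀ z : ℝ) * θ := q1
      _ = γ * supDist y₀ z := by rw [hγdef]; ring
  -- the local data: (S) the values on the ball `2r + L^k + 1 ≤ 4L^k`
  set S₀ : ℝ := c₁ * P.spacing k ^ 2 * F * Real.exp 6 * X with hS₀def
  have hS₀0 : 0 ≤ S₀ := by positivity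
  set S : ℝ := E * S₀ with hSdef
  have hS0 : 0 ≤ S := by positivity
  have hslack6 : Real.exp (-(t * ((Dst y₀ : ℝ) - (2 * r + P.L ^ k + 1 : ℕ)) / n)) *
      Real.exp (-(t * ((δB y₀ : ℝ) - (2 * r + P.L ^ k + 1 : ℕ)) / n)) ≤ E * Real.exp 6 := by
    set m : ℝ := ((2 * r + P.L ^ k + 1 : ℕ) : ℝ) with hmdef
    have q1 : m ≤ 3 * n := by rw [hmdef]; push_cast; linarith [hrn, hn1, hndef]
    have q2 : t * m ≤ 3 * n := by have := mul_le_mul ht1 q1 (by rw [hmdef]; positivity) zero_le_one; linarith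
    rw [← Real.exp_add, hEdef, ← Real.exp_add]
    refine Real.exp_le_exp.2 ?_
    have q3 : -(t * ((Dst y₀ : ℝ) - m) / n) + -(t * ((δB y₀ : ℝ) - m) / n) = -(t * ((Dst y₀ : ℝ) + δB y₀) / n) + 2 * (t * m) / n := by
      field_simp; ring
    rw [q3]
    have q4 : 2 * (t * m) / n ≤ 6 := by rw [div_le_iff₀ hn]; linarith
    linarith
  have hSψ : ∀ z, supDist y₀ z ≤ 2 * r + P.L ^ k + 1 → ‖ψ z‖ ≤ S := by
    intro z hz
    rw [hnormψ]
    have q1 := hvalue y₀ z (2 * r + P.L ^ k + 1) hy₀ hz (by omega) (Dst y₀ : ℝ)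
      (fun y hy => by exact_mod_cast hDst_le y₀ y hy)
    refine q1.trans ?_
    rw [hSdef, hS₀def]
    calc c₁ * P.spacing k ^ 2 * F * (Real.exp (-(t * ((Dst y₀ : ℝ) - (2 * r + P.L ^ k + 1 : ℕ)) / n)) *
          Real.exp (-(t * ((δB y₀ : ℝ) - (2 * r + P.L ^ k + 1 : ℕ)) / n))) * X
        ≤ c₁ * P.spacing k ^ 2 * F * (E * Real.exp 6) * X :=
          mul_le_mul_of_nonneg_right (mul_le_mul_of_nonneg_left hslack6 (by positivity)) hX0.le
      _ = _ := by ring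
  -- (M) the covariant differences on the ball `2r`: inside the region by `M`, on its collar by the two derivative members
  set Me : ℝ := 2 * (P.eps * (P.spacing k * (c₀ * F))) * Real.exp (28 * t) * X with hMedef
  have hMe0 : 0 ≤ Me := by positivity
  set Mloc : ℝ := (M + Me) * E * e with hMlocdef
  have hMloc0 : 0 ≤ Mloc := by positivity
  have hball_slack : ∀ z, supDist y₀ z ≤ 2 * r → Real.exp (-(t * ((Dst z : ℝ) + δB z) / n)) ≤ E * e := by
    intro z hz
    have q1 : ((Dst y₀ : ℕ) : ℝ) ≤ ((2 * r : ℕ) : ℝ) + Dst z := by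
      have := (hDst_tri y₀ z).trans (Nat.add_le_add_right hz _); exact_mod_cast this
    have q2 : ((δB y₀ : ℕ) : ℝ) ≤ (δB z : ℝ) + ((2 * r : ℕ) : ℝ) := by
      have := (depth_le_add h1 h2 y₀ z).trans (Nat.add_le_add_left hz _); exact_mod_cast this
    have q3 : 2 * ((2 * r : ℕ) : ℝ) ≤ n := by push_cast; linarith
    rw [hEdef, hedef]
    exact exp_ball hn ht.le ht1 (Nat.cast_nonneg _) q1 q2 q3
  have hMψ : ∀ z ν, supDist y₀ z ≤ 2 * r → ‖cfg U' ⟨z, ν⟩ * ψ (z.shift ν) - ψ z‖ ≤ Mloc := by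
    intro z ν hz
    rw [hcov, hMlocdef]
    have hslk := hball_slack z hz
    by_cases hzZ : 14 * P.L ^ k ≤ δB z
    · calc ‖cfg U ⟨z, ν⟩ * v (z.shift ν) - v z‖ ≤ M * Real.exp (-(t * ((Dst z : ℝ) + δB z) / n)) := hMuse z ν hzZ
        _ ≤ M * (E * e) := mul_le_mul_of_nonneg_left hslk hM0
        _ ≤ (M + Me) * (E * e) := by gcongr; linarith
        _ = _ := by ring
    · -- the collar of the region: both derivative members apply at `z` (its open `L^k`-ball lies in `□`)
      push Not at hzZ
      have hzball : ∀ y, B5Ineq137Torus.T P 0 z y < n → y ∈ B := by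
        intro y hy
        by_contra hyB
        have q1 := h1 z y hyB
        have q2 := depth_le_add h1 h2 y₀ z
        have q3 : P.L ^ k ≤ supDist z y := by omega
        rw [hT, ← hncast] at hy
        exact absurd (by exact_mod_cast hy : supDist z y < P.L ^ k) (not_lt.2 q3)
      have hsz : ∀ y, f y ≠ 0 → (Dst z : ℝ) ≤ B5Ineq137Torus.T P 0 z y := fun y hy => by
        rw [hT]; exact_mod_cast hDst_le z y hy
      have dB := hDB z hzball f F (Dst z) hF (Nat.cast_nonneg _) hsz ν
      have dΩ := hDΩ z hzball f F (Dst z) hF (Nat.cast_nonneg _) hsz ν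
      rw [norm_covD_apply] at dB dΩ
      have dB' : ‖cfg U ⟨z, ν⟩ * (gBox a' P.eps⁻¹ U k B *ᵥ f) (z.shift ν) - (gBox a' P.eps⁻¹ U k B *ᵥ f) z‖ ≤
          P.eps * (P.spacing k * (c₀ * Real.exp (-(δ₀ * (n⁻¹ * Dst z))) * F)) := (inv_mul_le_iff₀ hε).1 dB
      have dΩ' : ‖cfg U ⟨z, ν⟩ * (gBox a' P.eps⁻¹ U k Ω *ᵥ f) (z.shift ν) - (gBox a' P.eps⁻¹ U k Ω *ᵥ f) z‖ ≤
          P.eps * (P.spacing k * (c₀ * Real.exp (-(δ₀ * (n⁻¹ * Dst z))) * F)) := (inv_mul_le_iff₀ hε).1 dΩ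
      have hsplit : cfg U ⟨z, ν⟩ * v (z.shift ν) - v z =
          (cfg U ⟨z, ν⟩ * (gBox a' P.eps⁻¹ U k B *ᵥ f) (z.shift ν) - (gBox a' P.eps⁻¹ U k B *ᵥ f) z) -
          (cfg U ⟨z, ν⟩ * (gBox a' P.eps⁻¹ U k Ω *ᵥ f) (z.shift ν) - (gBox a' P.eps⁻¹ U k Ω *ᵥ f) z) := by
        simp only [hv]; ring
      -- the exponent on the collar
      obtain ⟨w, hw, hzw⟩ := hDst_ex z
      have hedge : Real.exp (-(δ₀ * (n⁻¹ * Dst z))) ≤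
          Real.exp (28 * t) * Real.exp (-(t * ((Dst z : ℝ) + δB z) / n)) * X := by
        rw [show δ₀ * (n⁻¹ * (Dst z : ℝ)) = δ₀ * (Dst z : ℝ) / n by ring, hXdef]
        refine exp_edge hn ht.le htδ₀ (Nat.cast_nonneg _) ?_ ?_
        · have := hDf_edge z w hw; rw [← hzw] at this; exact this
        · have : ((δB z : ℕ) : ℝ) ≤ ((14 * P.L ^ k : ℕ) : ℝ) := by exact_mod_cast hzZ.le
          push_cast at this; linarith [this, hndef]
      calc ‖cfg U ⟨z, ν⟩ * v (z.shift ν) - v z‖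
          ≤ P.eps * (P.spacing k * (c₀ * Real.exp (-(δ₀ * (n⁻¹ * Dst z))) * F)) +
            P.eps * (P.spacing k * (c₀ * Real.exp (-(δ₀ * (n⁻¹ * Dst z))) * F)) := by
            rw [hsplit]; exact (norm_sub_le _ _).trans (add_le_add dB' dΩ')
        _ = 2 * (P.eps * (P.spacing k * (c₀ * F))) * Real.exp (-(δ₀ * (n⁻¹ * Dst z))) := by ring
        _ ≤ 2 * (P.eps * (P.spacing k * (c₀ * F))) * (Real.exp (28 * t) * Real.exp (-(t * ((Dst z : ℝ) + δB z) / n)) * X) :=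
            mul_le_mul_of_nonneg_left hedge (by positivity)
        _ = Me * Real.exp (-(t * ((Dst z : ℝ) + δB z) / n)) := by rw [hMedef]; ring
        _ ≤ Me * (E * e) := mul_le_mul_of_nonneg_left hslk hMe0
        _ ≤ (M + Me) * (E * e) := by gcongr; linarith
        _ = _ := by ring
  -- (F) the source vanishes on the ball `2r` (harmonicity, transported by the gauge)
  have hFf' : ∀ z, supDist y₀ z ≤ 2 * r → ‖f' z‖ ≤ 0 := by
    intro z hz
    have q1 : f' = fun z => toC (hg z) * (nOp a' P.eps⁻¹ U k univ *ᵥ v) z := by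
      rw [hf'def, hψdef]; exact nOp_gaugeAct_mulVec_smul hk0 a' P.eps⁻¹ hg U v
    have q2 : (nOp a' P.eps⁻¹ U k univ *ᵥ v) z = 0 := hharm z (by have := depth_le_add h1 h2 y₀ z; omega)
    rw [q1]; simp only [q2, mul_zero, norm_zero, le_refl]
  -- THE LOCAL ESTIMATE
  have hmain := hloc P rfl ha hk1 hkK hr4 hN y₀ μ₀ U' ψ f' hψeq hγ0 hS0 hMloc0 le_rfl (fun z => hkerP.1 μ₀ y₀ z)
    (fun ν z => hkerP.2 μ₀ ν y₀ z) hgauge hSψ hMψ hFf'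
  -- its left-hand side is `M·E`
  have hLHS : ‖ψ (y₀.shift μ₀) - ψ y₀‖ = M * E := by
    have hu1 : cfg U' ⟨y₀, μ₀⟩ = 1 := by
      have q1 := hgauge y₀ μ₀ (by rw [(supDist_eq_zero_iff y₀ y₀).2 rfl]; exact Nat.zero_le _)
      rw [(supDist_eq_zero_iff y₀ y₀).2 rfl, Nat.cast_zero, mul_zero] at q1
      exact sub_eq_zero.1 (norm_le_zero_iff.1 q1)
    have q2 : ‖ψ (y₀.shift μ₀) - ψ y₀‖ = ‖cfg U ⟨y₀, μ₀⟩ * v (y₀.shift μ₀) - v y₀‖ := by rw [← hcov, hu1, one_mul]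
    rw [q2, hMdef, hgdef]
    show _ = Real.exp (t * ((Dst y₀ : ℝ) + δB y₀) / n) * ‖cfg U ⟨y₀, μ₀⟩ * v (y₀.shift μ₀) - v y₀‖ * E
    rw [mul_comm (Real.exp _), mul_assoc, hEinv, mul_one]
  rw [hLHS] at hmain
  -- `γ r² ≤ c²`, the contraction factor `κ = C_L e γ r² ≤ 1/2`
  have hγr : γ * (r : ℝ) ^ 2 ≤ c ^ 2 := by
    calc γ * (r : ℝ) ^ 2 ≤ γ * (c * n) ^ 2 := mul_le_mul_of_nonneg_left (pow_le_pow_left₀ hr0.le hrc 2) hγ0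
      _ = c ^ 2 * (γ * n ^ 2) := by ring
      _ ≤ c ^ 2 * 1 := mul_le_mul_of_nonneg_left hγn (sq_nonneg c)
      _ = c ^ 2 := mul_one _
  have hκ : C_L * (γ * (r : ℝ) ^ 2) * e ≤ 1 / 2 := by
    calc C_L * (γ * (r : ℝ) ^ 2) * e ≤ C_L * c ^ 2 * e := by gcongr
      _ = (C_L * e * c) * c := by ring
      _ ≤ (1 / 2) * 1 := mul_le_mul hcC hc1 hc0.le (by norm_num)
      _ = 1 / 2 := by norm_num
  -- divide by `E` and absorb
  set A₁ : ℝ := C_L * ((γ * r + 1 / r + B1RG242Torus.α P a k * P.eps ^ 2 * (r + n)) * S₀) with hA₁def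
  have hA₁0 : 0 ≤ A₁ := by positivity
  have hM_le : M ≤ Me + 2 * A₁ := by
    have q1 : M * E ≤ E * (A₁ + (C_L * (γ * (r : ℝ) ^ 2) * e) * (M + Me)) :=
      calc M * E ≤ C_L * (0 * P.eps ^ 2 * r + γ * r ^ 2 * Mloc + γ * r * S + S / r +
            B1RG242Torus.α P a k * P.eps ^ 2 * (r + n) * S) := hmain
        _ = E * (A₁ + (C_L * (γ * (r : ℝ) ^ 2) * e) * (M + Me)) := by
            simp only [hA₁def, hMlocdef, hSdef]
            ring
    have q2 : M ≤ A₁ + (C_L * (γ * (r : ℝ) ^ 2) * e) * (M + Me) := le_of_mul_le_mul_right (by linarith [q1]) hE0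
    have q3 : (C_L * (γ * (r : ℝ) ^ 2) * e) * (M + Me) ≤ (1 / 2) * (M + Me) := mul_le_mul_of_nonneg_right hκ (by positivity)
    linarith
  -- `A₁ ≤ C_L K₁ · n ε² F X`
  set Y : ℝ := n * P.eps ^ 2 * F * X with hYdef
  have hY0 : 0 ≤ Y := by positivity
  have hS₀Y : S₀ = c₁ * Real.exp 6 * n * Y := by rw [hS₀def, hYdef, hsp]; ring
  have hA₁le : A₁ ≤ C_L * K₁ * Y := by
    have q2 : γ * r * n ≤ c := by
      calc γ * r * n ≤ γ * (c * n) * n := mul_le_mul_of_nonneg_right (mul_le_mul_of_nonneg_left hrc hγ0) hn.le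
        _ = c * (γ * n ^ 2) := by ring
        _ ≤ c * 1 := mul_le_mul_of_nonneg_left hγn hc0.le
        _ = c := mul_one _
    have q3 : 1 / (r : ℝ) * n ≤ 2 / c := by
      rw [one_div_mul_eq_div, div_le_div_iff₀ hr0 hc0]
      linarith [hr2]
    have q4 : B1RG242Torus.α P a k * P.eps ^ 2 * (r + n) * n ≤ 2 * a := by
      have q5 : (r : ℝ) + n ≤ 2 * n := by linarith [hrn, hn.le]
      have q6 : B1RG242Torus.α P a k * P.eps ^ 2 * n * n = B1RG242Torus.α P a k * P.spacing k ^ 2 := by rw [hsp]; ring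
      calc B1RG242Torus.α P a k * P.eps ^ 2 * (r + n) * n ≤ B1RG242Torus.α P a k * P.eps ^ 2 * (2 * n) * n :=
            mul_le_mul_of_nonneg_right (mul_le_mul_of_nonneg_left q5 (by positivity)) hn.le
        _ = 2 * (B1RG242Torus.α P a k * P.spacing k ^ 2) := by rw [← q6]; ring
        _ ≤ 2 * a := by linarith [hαa]
    have hsum : (γ * r + 1 / r + B1RG242Torus.α P a k * P.eps ^ 2 * (r + n)) * n ≤ c + 2 / c + 2 * a := by
      have : (γ * r + 1 / r + B1RG242Torus.α P a k * P.eps ^ 2 * (r + n)) * n =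
          γ * r * n + 1 / (r : ℝ) * n + B1RG242Torus.α P a k * P.eps ^ 2 * (r + n) * n := by ring
      rw [this]; linarith
    rw [hA₁def, hS₀Y, hK₁]
    calc C_L * ((γ * r + 1 / r + B1RG242Torus.α P a k * P.eps ^ 2 * (r + n)) * (c₁ * Real.exp 6 * n * Y))
        = C_L * (c₁ * Real.exp 6) * Y * ((γ * r + 1 / r + B1RG242Torus.α P a k * P.eps ^ 2 * (r + n)) * n) := by ring
      _ ≤ C_L * (c₁ * Real.exp 6) * Y * (c + 2 / c + 2 * a) := mul_le_mul_of_nonneg_left hsum (by positivity)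
      _ = C_L * (c₁ * Real.exp 6 * (c + 2 / c + 2 * a)) * Y := by ring
  have hMe_le : Me ≤ 2 * Real.exp 29 * c₀ * Y := by
    have q1 : Real.exp (28 * t) ≤ Real.exp 29 := Real.exp_le_exp.2 (by linarith)
    calc Me = 2 * c₀ * Real.exp (28 * t) * Y := by rw [hMedef, hYdef, hsp]; ring
      _ ≤ 2 * c₀ * Real.exp 29 * Y := mul_le_mul_of_nonneg_right (mul_le_mul_of_nonneg_left q1 (by positivity)) hY0
      _ = _ := by ring
  -- conclusion at the bond `⟨x, μ⟩`
  have hDx : D ≤ (Dst x : ℝ) := by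
    obtain ⟨w, hw, h⟩ := hDst_ex x
    rw [h, ← hT]; exact hsD w hw
  have hDbx : Db ≤ (δB x : ℝ) := by have := hsDb w₀ hw₀; rwa [hT, ← hδx] at this
  have hMtot : M ≤ (2 * C_L * K₁ + 2 * Real.exp 29 * c₀) * Y := by linarith [hM_le, hA₁le, hMe_le]
  have hδxbound : ‖cfg U ⟨x, μ⟩ * v (x.shift μ) - v x‖ ≤
      (2 * C_L * K₁ + 2 * Real.exp 29 * c₀) * Y * (Real.exp (-(t * D / n)) * Real.exp (-(t * Db / n))) := by
    refine (hMuse x μ hδx14).trans ?_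
    have q2 : Real.exp (-(t * ((Dst x : ℝ) + δB x) / n)) ≤ Real.exp (-(t * D / n)) * Real.exp (-(t * Db / n)) := by
      rw [← Real.exp_add]
      refine Real.exp_le_exp.2 ?_
      rw [show -(t * D / n) + -(t * Db / n) = -(t * (D + Db) / n) by ring, neg_le_neg_iff]
      exact div_le_div_of_nonneg_right (mul_le_mul_of_nonneg_left (add_le_add hDx hDbx) ht.le) hn.le
    exact mul_le_mul hMtot q2 (Real.exp_pos _).le (by positivity)
  calc P.eps⁻¹ * ‖cfg U ⟨x, μ⟩ * v (x.shift μ) - v x‖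
      ≤ P.eps⁻¹ * ((2 * C_L * K₁ + 2 * Real.exp 29 * c₀) * Y * (Real.exp (-(t * D / n)) * Real.exp (-(t * Db / n)))) :=
        mul_le_mul_of_nonneg_left hδxbound (inv_nonneg.2 hε.le)
    _ = (2 * C_L * K₁ + 2 * Real.exp 29 * c₀) * P.spacing k * F * (Real.exp (-(t * D / n)) * Real.exp (-(t * Db / n))) * X := by
        rw [hYdef, hsp]; field_simp
    _ ≤ c₂ * P.spacing k * F * (Real.exp (-(t * D / n)) * Real.exp (-(t * Db / n))) * X :=
        mul_le_mul_of_nonneg_right (mul_le_mul_of_nonneg_right (mul_le_mul_of_nonneg_right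
          (mul_le_mul_of_nonneg_right hc₂a hsp0.le) hF0) (by positivity)) hX0.le
    _ = P.spacing k * (c₂ * Real.exp (-(t * D / n)) * (Real.exp (-(t * Db / n)) * X) * F) := by ring

/-- **THE SAME MEMBER IN THE DEEP-ROW BINDER SHAPE OF r01 / p34** (`BIJ85NeumannPropagatorRegularDeriv.input112_deriv_regular_deep`,
`BIJ88NeumannPropagatorSmallFieldCubeDeriv.decay110_smallField_cube_deriv_input`): the row condition is written
`{y : |x − y|_∞ ≤ 14L^k} ⊆ □` (then `x ∈ □` and `dist_∞(x, T ∖ □) > 14L^k`).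
[cite: Balaban1983RegularityDecay, Theorem p.573 (1.10)–(1.12)] [cite: BalabanImbrieJaffe1985, (7.3.1) p.326] -/
theorem close112_smallField_deriv_deep (d L : ℕ) (hd : 2 ≤ d) (hd3 : d ≤ 3) (hL : Odd L ∧ 1 < L) {a : ℝ} (ha : 0 < a)
    {c₀ δ₀ : ℝ} (hc₀ : 0 ≤ c₀) (hδ₀ : 0 < δ₀) :
    ∃ c₂ δ₂ : ℝ, 0 < c₂ ∧ 0 < δ₂ ∧ ∀ (P : Params), P.d = d → P.L = L → ∀ k : ℕ, 1 ≤ k → k ≤ P.K →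
      ∀ (U : GaugeField P 0 U1) (θ : ℝ), (∀ (y : Balaban1983to89.Site P 0) (μ ν : Fin P.d), ‖BIJ85AbelianStokes.plaqC U y μ ν - 1‖ ≤ θ) →
      2 * (P.d : ℝ) ^ 3 * (((P.L : ℝ) ^ k) ^ 2 * θ) ^ 2 ≤ 1 →
      ∀ (B Ω : Finset (Balaban1983to89.Site P 0)), IsBlockUnion k B → IsBlockUnion k Ω → B ⊆ Ω →
      (∀ x ∈ B, ∀ (f : Balaban1983to89.Site P 0 → ℂ) (F D : ℝ), (∀ y, ‖f y‖ ≤ F) → 0 ≤ D →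
          (∀ y, f y ≠ 0 → D ≤ B5Ineq137Torus.T P 0 x y) →
          ‖(gBox (B1RG242Torus.α P a k * (P.L : ℝ) ^ (k * P.d)) P.eps⁻¹ U k B *ᵥ f) x‖ ≤
            P.spacing k ^ 2 * (c₀ * Real.exp (-(δ₀ * (((P.L : ℝ) ^ k)⁻¹ * D))) * F)) →
      (∀ x ∈ B, ∀ (f : Balaban1983to89.Site P 0 → ℂ) (F D : ℝ), (∀ y, ‖f y‖ ≤ F) → 0 ≤ D →
          (∀ y, f y ≠ 0 → D ≤ B5Ineq137Torus.T P 0 x y) →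
          ‖(gBox (B1RG242Torus.α P a k * (P.L : ℝ) ^ (k * P.d)) P.eps⁻¹ U k Ω *ᵥ f) x‖ ≤
            P.spacing k ^ 2 * (c₀ * Real.exp (-(δ₀ * (((P.L : ℝ) ^ k)⁻¹ * D))) * F)) →
      (∀ x, (∀ y, B5Ineq137Torus.T P 0 x y < (P.L : ℝ) ^ k → y ∈ B) →
          ∀ (f : Balaban1983to89.Site P 0 → ℂ) (F D : ℝ), (∀ y, ‖f y‖ ≤ F) → 0 ≤ D →
          (∀ y, f y ≠ 0 → D ≤ B5Ineq137Torus.T P 0 x y) → ∀ (μ : Fin P.d),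
          ‖covD P.eps⁻¹ (cfg U) (gBox (B1RG242Torus.α P a k * (P.L : ℝ) ^ (k * P.d)) P.eps⁻¹ U k B *ᵥ f) ⟨x, μ⟩‖ ≤
            P.spacing k * (c₀ * Real.exp (-(δ₀ * (((P.L : ℝ) ^ k)⁻¹ * D))) * F)) →
      (∀ x, (∀ y, B5Ineq137Torus.T P 0 x y < (P.L : ℝ) ^ k → y ∈ B) →
          ∀ (f : Balaban1983to89.Site P 0 → ℂ) (F D : ℝ), (∀ y, ‖f y‖ ≤ F) → 0 ≤ D →
          (∀ y, f y ≠ 0 → D ≤ B5Ineq137Torus.T P 0 x y) → ∀ (μ : Fin P.d),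
          ‖covD P.eps⁻¹ (cfg U) (gBox (B1RG242Torus.α P a k * (P.L : ℝ) ^ (k * P.d)) P.eps⁻¹ U k Ω *ᵥ f) ⟨x, μ⟩‖ ≤
            P.spacing k * (c₀ * Real.exp (-(δ₀ * (((P.L : ℝ) ^ k)⁻¹ * D))) * F)) →
      ∀ (x : Balaban1983to89.Site P 0), (∀ y, B5Ineq137Torus.T P 0 x y ≤ ((14 * L ^ k : ℕ) : ℝ) → y ∈ B) →
      ∀ (f : Balaban1983to89.Site P 0 → ℂ) (F D Db Df : ℝ), (∀ y, ‖f y‖ ≤ F) → (∀ y, y ∉ B → f y = 0) →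
        0 ≤ D → (∀ y, f y ≠ 0 → D ≤ B5Ineq137Torus.T P 0 x y) → 0 ≤ Db → (∀ w, w ∉ B → Db ≤ B5Ineq137Torus.T P 0 x w) →
        0 ≤ Df → (∀ y, f y ≠ 0 → ∀ w, w ∉ B → Df ≤ B5Ineq137Torus.T P 0 y w) → ∀ (μ : Fin P.d),
        ‖covD P.eps⁻¹ (cfg U) (gBox (B1RG242Torus.α P a k * (P.L : ℝ) ^ (k * P.d)) P.eps⁻¹ U k B *ᵥ f) ⟨x, μ⟩ -
            covD P.eps⁻¹ (cfg U) (gBox (B1RG242Torus.α P a k * (P.L : ℝ) ^ (k * P.d)) P.eps⁻¹ U k Ω *ᵥ f) ⟨x, μ⟩‖ ≤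
          P.spacing k * (c₂ * Real.exp (-(δ₂ * (((P.L : ℝ) ^ k)⁻¹ * D))) *
            Real.exp (-(δ₂ * (((P.L : ℝ) ^ k)⁻¹ * (Db + Df)))) * F) := by
  obtain ⟨c₂, δ₂, hc₂, hδ₂, H⟩ := close112_smallField_deriv_of_inputs d L hd hd3 hL ha hc₀ hδ₀
  refine ⟨c₂, δ₂, hc₂, hδ₂, ?_⟩
  intro P hPd hPL k hk1 hkK U θ hθ hsmall B Ω hB hΩ hsub hGB hGΩ hDB hDΩ x hdeep f F D Db Df hF hfB hD hsD hDb hsDb hDf hsDf μ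
  have hx0 : B5Ineq137Torus.T P 0 x x ≤ ((14 * L ^ k : ℕ) : ℝ) := by
    rw [B3Bound323ZeroTorus.T_eq_supDist, (supDist_eq_zero_iff x x).2 rfl, Nat.cast_zero]; exact Nat.cast_nonneg _
  have hxB : x ∈ B := hdeep x hx0
  refine H P hPd hPL k hk1 hkK U θ hθ hsmall B Ω hB hΩ hsub hGB hGΩ hDB hDΩ x hxB (fun w hw => ?_) f F D Db Df hF hfB hD hsD hDb hsDb
    hDf hsDf μ
  have h1 : ¬ B5Ineq137Torus.T P 0 x w ≤ ((14 * L ^ k : ℕ) : ℝ) := fun h => hw (hdeep w h)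
  have h2 : ((14 * L ^ k : ℕ) : ℝ) = 14 * (P.L : ℝ) ^ k := by rw [← hPL]; push_cast; ring
  rw [h2] at h1
  exact (not_le.1 h1).le

end

end Literature.MathematicalPhysics.QuantumFieldTheory.BalabanImbrieJaffe1984to88.BIJ88NeumannPropagatorSmallFieldCloseDeriv
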